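import Summits.FinalStateConjecture.FinalStateConjecture.Theorems.BartnikGapSettlingGapExhaustionCylindersExactMargin
import Literature.Geometry.Lorentzian.KerrRegionIISpeedBound
import HarnessLib

/-!
# Crux `SettledCapture` (stmt-FinalStateConjecture-17328), line `null-concave-crush`:
# the two soft SHELL CONSTANTS of exact Kerr behind stub 2 `stub_kerrCrushCertificate`

Route `BartnikGapSettling`; helper (`--supports stmt-FinalStateConjecture-17328`, registered sub-goal
`stub_crushSlopeConstant`) for the registered stub `stub_kerrCrushCertificate` of the checked skeleton
`Cruxes/SettledCapture/Lines/null_concave_crush.lean`. On the ingoing-Kerr–Schild shell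
`{r₁ ≤ r ≤ r₂} ⊆ {r₋ < r < r₊}` of a sub-extremal Kerr black-hole interior (block II):

* `crush_fderiv_radius_neg_of_future`, `crush_fderiv_radius_ne_zero_of_null` — pointwise: `dr(w) < 0` for every
  future-directed null `w` (`r` is a time function on block II, `Kerr.radiusGrad_lt_zero_of_isFutureDirected`), hence
  `dr(w) ≠ 0` for every non-zero null `w` (one of `±w` is future-directed since `V = −g♯dt*` is timelike);
* `stub_crushSlopeConstant` — **quantitative timelike gradient**: `c > 0` with `c‖w‖ ≤ |dr(w)|` for all null `w`
  at all shell points (all Kerr-star times);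
* `crush_hess_constant` — `C ≥ 0` with `|Hess r(w,w)| ≤ C‖w‖²` at all shell points, `Hess` the coordinate Hessian
  `MetricCoord.hessAt (Kerr.bilin M a) (Kerr.radius a)`.

Uniformity: the normalised constraint set over the time slice `{z⁰ = 0}` of the shell is compact, the maps are
continuous there (`kerrCylindersExactMargin_continuousOn_*`), and homogeneity in `w` plus stationarity
(`Kerr.bilin_add_time`, `Kerr.radius_add_time_smul_basisVector`, `fderiv_radius_add_time`,
`kerrCylindersExactMargin_hessAt_add_time`) remove the normalisations — the template of
`stub_kerrCylindersExactMargin` (crux `GapExhaustion`). References: O'Neill 1995 §2.5; O'Neill 1983 Ch. 5 p. 145.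
-/

noncomputable section

-- instance search through the nested operator types `E4 →L[ℝ] E4 →L[ℝ] E4 →L[ℝ] ℝ`
set_option maxSynthPendingDepth 3

-- D-0017: single-problem summit, `Summit.<S>.<S>.…` by design (cf. lakefile `weak.linter.dupNamespace`).
set_option linter.dupNamespace false

namespace Summit.FinalStateConjecture.FinalStateConjecture.Theorems.BartnikGapSettling.SettledCapture

open Set Filter Function TopologicalSpace
open scoped Topology
open Literature.Geometry.Lorentzian Literature.Geometry.Lorentzian.MetricCoord
open Summit.FinalStateConjecture.FinalStateConjecture.Theorems

/-! ### Pointwise: on block II, `dr` never vanishes on non-zero null vectors -/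

/-- The Kerr–Schild chart facts, discharged (tree theorems). -/
private theorem crush_kerrFacts : Kerr.Facts :=
  ⟨Kerr.isConnected_region_holds, Kerr.contMDiff_bilin_holds, Kerr.contMDiff_timeVector_holds⟩

/-- `dr_z(w) = g_z(W, w)` with `W = Kerr.radiusGradVector` the metric gradient of `r` (`r > 0`). [folklore] -/
theorem crush_fderiv_radius_eq_bilin {M a : ℝ} {z : E4} (hz : 0 < Kerr.radius a z) (w : E4) :
    fderiv ℝ (Kerr.radius a) z w = Kerr.bilin M a z (Kerr.radiusGradVector M a z) w := by
  rw [(Kerr.hasFDerivAt_radius_bilin (M := M) hz).fderiv]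

/-- **On block II, `dr(w) < 0` for every future-directed null `w`** (`g(w,w) = 0`, `g(V, w) < 0`,
`V = Kerr.timeVector`): `r` is a time function there (O'Neill 1995, §2.5). [folklore] -/
theorem crush_fderiv_radius_neg_of_future {M a : ℝ} (ha : |a| < M) {z : E4}
    (h₁ : Kerr.rMinus M a < Kerr.radius a z) (h₂ : Kerr.radius a z < Kerr.rPlus M a) {w : E4}
    (hnull : Kerr.bilin M a z w w = 0) (hfut : Kerr.bilin M a z (Kerr.timeVector M a z) w < 0) :
    fderiv ℝ (Kerr.radius a) z w < 0 := by
  haveI : Kerr.Facts := crush_kerrFacts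
  have hz : 0 < Kerr.radius a z := (Kerr.IsSubextremal.rMinus_nonneg ha).trans_lt h₁
  have hw : w ≠ 0 := by
    rintro rfl
    simp at hfut
  have key := Kerr.radiusGrad_lt_zero_of_isFutureDirected ha h₁ h₂ hnull.le hw hfut
  rwa [← Kerr.bilin_radiusGradVector (M := M) hz w, ← crush_fderiv_radius_eq_bilin hz] at key

/-- **On block II, `dr(w) ≠ 0` for every non-zero null `w`**: `V` is timelike, so `g(V, w) ≠ 0`
(`Kerr.bilin_pos_of_orthogonal`), and `dr(±w) < 0` for the future-directed one of `±w`. [folklore] -/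
theorem crush_fderiv_radius_ne_zero_of_null {M a : ℝ} (hM : 0 < M) (ha : |a| < M) {z : E4}
    (h₁ : Kerr.rMinus M a < Kerr.radius a z) (h₂ : Kerr.radius a z < Kerr.rPlus M a) {w : E4}
    (hw : w ≠ 0) (hnull : Kerr.bilin M a z w w = 0) :
    fderiv ℝ (Kerr.radius a) z w ≠ 0 := by
  have hz : 0 < Kerr.radius a z := (Kerr.IsSubextremal.rMinus_nonneg ha).trans_lt h₁
  have hVw : Kerr.bilin M a z (Kerr.timeVector M a z) w ≠ 0 := by
    intro h0
    have hpos := Kerr.bilin_pos_of_orthogonal M a hz (Kerr.timeVector M a z) w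
      (Kerr.bilin_timeVector_timeVector_neg hM.le a hz) h0 hw
    linarith
  rcases hVw.lt_or_gt with hlt | hgt
  · exact (crush_fderiv_radius_neg_of_future ha h₁ h₂ hnull hlt).ne
  · have hnull' : Kerr.bilin M a z (-w) (-w) = 0 := by
      simp only [map_neg, neg_apply, neg_neg, hnull]
    have hfut' : Kerr.bilin M a z (Kerr.timeVector M a z) (-w) < 0 := by
      rw [map_neg]; linarith
    have h := crush_fderiv_radius_neg_of_future ha h₁ h₂ hnull' hfut'
    rw [map_neg] at h
    intro h0
    rw [h0, neg_zero] at h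
    exact lt_irrefl _ h

/-! ### Uniform shell constants (compactness of the `{z⁰ = 0}` slice + stationarity) -/

/-- **Quantitative timelike gradient on the shell** (registered sub-goal `stub_crushSlopeConstant` of crux
`SettledCapture`, line `null-concave-crush`): for `0 < M`, `|a| < M` and a shell `r₋ < r₁ ≤ r ≤ r₂ < r₊` there is
`c > 0` with `c‖w‖ ≤ |dr_z(w)|` for every `g_{M,a}`-null `w` at every shell point (all Kerr-star times). [folklore] -/
theorem stub_crushSlopeConstant : ∀ (M a r₁ r₂ : ℝ), 0 < M → |a| < M → Kerr.rMinus M a < r₁ → r₂ < Kerr.rPlus M a → ∃ c : ℝ, 0 < c ∧ ∀ (z w : E4), r₁ ≤ Kerr.radius a z → Kerr.radius a z ≤ r₂ → Kerr.bilin M a z w w = 0 → c * ‖w‖ ≤ |fderiv ℝ (Kerr.radius a) z w| := by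
  intro M a r₁ r₂ hM ha h₁ h₂
  have hr₁ : 0 < r₁ := (Kerr.IsSubextremal.rMinus_nonneg ha).trans_lt h₁
  -- the normalised constraint set on the slice `{z⁰ = 0}`
  set S : Set E4 := {z : E4 | z 0 = 0 ∧ r₁ ≤ Kerr.radius a z ∧ Kerr.radius a z ≤ r₂} with hS
  set K : Set (E4 × E4) := {p | p.1 ∈ S ∧ ‖p.2‖ = 1 ∧ Kerr.bilin M a p.1 p.2 p.2 = 0} with hK
  have hSc : IsCompact S := kerrCylindersBendInward_isCompact_slice a r₂ hr₁
  have hSreg : S ⊆ (Kerr.region a 0 : Set E4) := fun z hz ↦ by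
    have : max 0 0 < Kerr.radius a z := by rw [max_self]; exact hr₁.trans_le hz.2.1
    exact this
  have hB : IsCompact (S ×ˢ Metric.sphere (0 : E4) 1) := hSc.prod (isCompact_sphere 0 1)
  have hBreg : S ×ˢ Metric.sphere (0 : E4) 1 ⊆ (Kerr.region a 0 : Set E4) ×ˢ (univ : Set E4) :=
    prod_mono hSreg (subset_univ _)
  have hKeq : K = (S ×ˢ Metric.sphere (0 : E4) 1) ∩
      (fun p : E4 × E4 ↦ Kerr.bilin M a p.1 p.2 p.2) ⁻¹' {0} := by
    ext p
    simp only [hK, mem_setOf_eq, mem_inter_iff, mem_prod, mem_sphere_iff_norm, sub_zero,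
      mem_preimage, mem_singleton_iff]
    tauto
  have hKc : IsCompact K := by
    have h1 : IsClosed ((S ×ˢ Metric.sphere (0 : E4) 1) ∩
        (fun p : E4 × E4 ↦ Kerr.bilin M a p.1 p.2 p.2) ⁻¹' {0}) :=
      ((kerrCylindersExactMargin_continuousOn_bilin_apply M a 0).mono hBreg).preimage_isClosed_of_isClosed
        hB.isClosed isClosed_singleton
    rw [hKeq]
    exact hB.of_isClosed_subset h1 inter_subset_left
  -- `|dr|` is continuous on `K` and positive there
  set Fn : E4 × E4 → ℝ := fun p ↦ |fderiv ℝ (Kerr.radius a) p.1 p.2| with hFn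
  have hFc : ContinuousOn Fn K := by
    refine (continuous_abs.comp_continuousOn
      (kerrCylindersExactMargin_continuousOn_fderiv_radius_apply a 0)).mono fun p hp ↦ ?_
    exact ⟨hSreg hp.1, mem_univ _⟩
  have hFpos : ∀ p ∈ K, 0 < Fn p := by
    rintro ⟨z, w⟩ ⟨hz, hw1, hnull⟩
    have hw : w ≠ 0 := by
      rintro rfl; simp at hw1
    exact abs_pos.2 (crush_fderiv_radius_ne_zero_of_null hM ha (h₁.trans_le hz.2.1)
      (lt_of_le_of_lt hz.2.2 h₂) hw hnull)
  -- the constant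
  obtain ⟨c, hc, hcK⟩ : ∃ c : ℝ, 0 < c ∧ ∀ p ∈ K, c ≤ Fn p := by
    by_cases hne : K.Nonempty
    · obtain ⟨p₀, hp₀, hmin⟩ := hKc.exists_isMinOn hne hFc
      exact ⟨Fn p₀, hFpos p₀ hp₀, fun p hp ↦ hmin hp⟩
    · exact ⟨1, one_pos, fun p hp ↦ absurd ⟨p, hp⟩ hne⟩
  refine ⟨c, hc, fun z w hz₁ hz₂ hnull ↦ ?_⟩
  by_cases hw : w = 0
  · subst hw; simp
  -- normalise: translate to the slice and rescale `w`
  set t : ℝ := z 0 with ht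
  set z' : E4 := z + (-t) • E4.basisVector 0 with hz'
  clear_value t
  have hrad : Kerr.radius a z' = Kerr.radius a z := Kerr.radius_add_time_smul_basisVector a z (-t)
  have hbil : Kerr.bilin M a z' = Kerr.bilin M a z := Kerr.bilin_add_time M a (-t) z
  have hfd : fderiv ℝ (Kerr.radius a) z' = fderiv ℝ (Kerr.radius a) z :=
    SwallowTheDatum.KerrShieldedSettles.KerrExteriorFlatDecay.fderiv_radius_add_time a z (-t)
  have hz'0 : z' 0 = 0 := by
    simp [hz', ht, E4.basisVector]
  clear_value z'
  set n : ℝ := ‖w‖ with hn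
  have hn0 : 0 < n := by rw [hn]; exact norm_pos_iff.2 hw
  clear_value n
  set v : E4 := n⁻¹ • w with hv
  clear_value v
  have hv1 : ‖v‖ = 1 := by
    rw [hv, norm_smul, norm_inv, Real.norm_eq_abs, abs_of_pos hn0, ← hn, inv_mul_cancel₀ hn0.ne']
  have hwv : w = n • v := by
    rw [hv, smul_smul, mul_inv_cancel₀ hn0.ne', one_smul]
  have hnull' : Kerr.bilin M a z' v v = 0 := by
    rw [hbil, hv, map_smul, map_smul, smul_apply, smul_eq_mul, smul_eq_mul, hnull, mul_zero,
      mul_zero]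
  have hmem : (z', v) ∈ K := ⟨⟨hz'0, hrad ▸ hz₁, hrad ▸ hz₂⟩, hv1, hnull'⟩
  have hle : c ≤ |fderiv ℝ (Kerr.radius a) z v| := by
    have := hcK _ hmem
    simp only [hFn] at this
    rwa [hfd] at this
  have hsc : fderiv ℝ (Kerr.radius a) z w = n * fderiv ℝ (Kerr.radius a) z v := by
    rw [hwv, map_smul, smul_eq_mul]
  rw [hsc, abs_mul, abs_of_pos hn0]
  nlinarith

/-- **Uniform bound for the Hessian of `r` on the shell**: for a shell `0 < r₁ ≤ r ≤ r₂` there is `C ≥ 0`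
with `|Hess r_z(w,w)| ≤ C‖w‖²` for every `w` at every shell point (all Kerr-star times). [folklore] -/
theorem crush_hess_constant (M a : ℝ) {r₁ : ℝ} (r₂ : ℝ) (hr₁ : 0 < r₁) :
    ∃ C : ℝ, 0 ≤ C ∧ ∀ (z w : E4), r₁ ≤ Kerr.radius a z → Kerr.radius a z ≤ r₂ →
      |hessAt (Kerr.bilin M a) (Kerr.radius a) z w w| ≤ C * ‖w‖ ^ 2 := by
  set S : Set E4 := {z : E4 | z 0 = 0 ∧ r₁ ≤ Kerr.radius a z ∧ Kerr.radius a z ≤ r₂} with hS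
  have hSc : IsCompact S := kerrCylindersBendInward_isCompact_slice a r₂ hr₁
  have hSreg : S ⊆ (Kerr.region a 0 : Set E4) := fun z hz ↦ by
    have : max 0 0 < Kerr.radius a z := by rw [max_self]; exact hr₁.trans_le hz.2.1
    exact this
  have hB : IsCompact (S ×ˢ Metric.sphere (0 : E4) 1) := hSc.prod (isCompact_sphere 0 1)
  have hBreg : S ×ˢ Metric.sphere (0 : E4) 1 ⊆ (Kerr.region a 0 : Set E4) ×ˢ (univ : Set E4) :=
    prod_mono hSreg (subset_univ _)
  set Fn : E4 × E4 → ℝ := fun p ↦ |hessAt (Kerr.bilin M a) (Kerr.radius a) p.1 p.2 p.2| with hFn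
  have hFc : ContinuousOn Fn (S ×ˢ Metric.sphere (0 : E4) 1) :=
    (continuous_abs.comp_continuousOn (kerrCylindersExactMargin_continuousOn_hessAt_apply M a 0)).mono hBreg
  -- the bound
  obtain ⟨C, hC0, hCK⟩ : ∃ C : ℝ, 0 ≤ C ∧ ∀ p ∈ S ×ˢ Metric.sphere (0 : E4) 1, Fn p ≤ C := by
    by_cases hne : (S ×ˢ Metric.sphere (0 : E4) 1).Nonempty
    · obtain ⟨p₀, hp₀, hmax⟩ := hB.exists_isMaxOn hne hFc
      exact ⟨Fn p₀, abs_nonneg _, fun p hp ↦ hmax hp⟩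
    · exact ⟨0, le_rfl, fun p hp ↦ absurd ⟨p, hp⟩ hne⟩
  refine ⟨C, hC0, fun z w hz₁ hz₂ ↦ ?_⟩
  by_cases hw : w = 0
  · subst hw; simp
  set t : ℝ := z 0 with ht
  set z' : E4 := z + (-t) • E4.basisVector 0 with hz'
  clear_value t
  have hrad : Kerr.radius a z' = Kerr.radius a z := Kerr.radius_add_time_smul_basisVector a z (-t)
  have hhess : hessAt (Kerr.bilin M a) (Kerr.radius a) z' = hessAt (Kerr.bilin M a) (Kerr.radius a) z :=
    kerrCylindersExactMargin_hessAt_add_time M a z (-t)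
  have hz'0 : z' 0 = 0 := by
    simp [hz', ht, E4.basisVector]
  clear_value z'
  set n : ℝ := ‖w‖ with hn
  have hn0 : 0 < n := by rw [hn]; exact norm_pos_iff.2 hw
  clear_value n
  set v : E4 := n⁻¹ • w with hv
  clear_value v
  have hv1 : ‖v‖ = 1 := by
    rw [hv, norm_smul, norm_inv, Real.norm_eq_abs, abs_of_pos hn0, ← hn, inv_mul_cancel₀ hn0.ne']
  have hwv : w = n • v := by
    rw [hv, smul_smul, mul_inv_cancel₀ hn0.ne', one_smul]
  have hmem : (z', v) ∈ S ×ˢ Metric.sphere (0 : E4) 1 :=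
    ⟨⟨hz'0, hrad ▸ hz₁, hrad ▸ hz₂⟩, by simpa using hv1⟩
  have hle : |hessAt (Kerr.bilin M a) (Kerr.radius a) z v v| ≤ C := by
    have := hCK _ hmem
    simp only [hFn] at this
    rwa [hhess] at this
  have hsc : hessAt (Kerr.bilin M a) (Kerr.radius a) z w w =
      n ^ 2 * hessAt (Kerr.bilin M a) (Kerr.radius a) z v v := by
    rw [hwv]
    simp only [map_smul, smul_apply, smul_eq_mul]
    ring
  rw [hsc, abs_mul, abs_of_nonneg (sq_nonneg n)]
  have hn2 : 0 ≤ n ^ 2 := sq_nonneg n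
  nlinarith

end Summit.FinalStateConjecture.FinalStateConjecture.Theorems.BartnikGapSettling.SettledCapture

end
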